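import Literature.NumberTheory.Automorphic.CongruenceSubgroupPropertySL2Multiplicative
import HarnessLib

/-!
# Serre's congruence subgroup property for `SL₂(𝓞_F)` — proofs, XIX: Liehl's (7) (MS2)

Topic `Literature/NumberTheory/Automorphic`; namespace `Literature.NumberTheory.Automorphic.SL2Rel`.
Everything here is PROVED; no definitions.

**(7)** for the pair `(I₁, I₂) = (𝔮, A)` (where Liehl's hypothesis `a - 1 ∈ I₁I₂(I₁ + I₂) = 𝔮` is
automatic): `[b₁b₂ over a] = [b₁ over a][b₂ over a]` (`sym_mul_right`).  Proof as printed (p. 162)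
with `t = 1 - a` (Liehl writes `a - 1 = t` but his last line `[b] = [b(1 - a)] = [bt]` needs
`t = 1 - a`; every other step holds for both signs): `[bt² over 1 + bt] = 1`; by (14) and (15) = (6)
`[bt² over a] = [-ta over a + bt]`; hence `[b₁t²][b₂t²] = [-ta over a + b₁t][-ta over a + b₂t] =
[-ta over a + b₁b₂t²] = [b₁b₂t³]`, and `[b] = [bt] = [bt²] = …` by (6).

Consequently the symbol is a Mennicke symbol on `W_𝔮` in the sense of BMS (MS1 = (6), file XIV;
MS2 = (7)), with values in `G(𝔮, A) ⧸ ncl E(𝔮, A)` — Vaserstein's Lemma 3 for `I₁ = 𝔮`, `I₂ = A`; it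
is packaged as a `SerreSL2.MennickeSymbol` in the final file.

## References

* [Liehl1981SL2Orders] B. Liehl, J. reine angew. Math. 323 (1981) 153–171, §3 (7), (14), (15).
* [Vaserstein1972SL2] L. N. Vaserstein, Mat. Sb. 89 (131) (1972) 313–322, Lemma 3.
-/

open Matrix MatrixGroups NumberField

namespace Literature.NumberTheory.Automorphic

namespace SL2Rel

section NumberField

variable {K : Type} [Field K] [NumberField K]
variable (hreal : ∃ w : InfinitePlace K, w.IsReal) (hunit : ∃ v : (𝓞 K)ˣ, ∀ n : ℕ, n ≠ 0 → v ^ n ≠ 1)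
include hreal hunit

omit [NumberField K] hreal hunit in
/-- `[b over a] = [b(1 - a) over a]` by (6) (`x = -b`). [cite: Liehl1981SL2Orders, §3 (7) (proof)] -/
theorem sym_eq_sym_mul_one_sub {𝔮 : Ideal (𝓞 K)} {a b : 𝓞 K} (ha : a - 1 ∈ 𝔮) (hb : b ∈ 𝔮)
    (hab : IsCoprime a b) : sym 𝔮 a b = sym 𝔮 a (b * (1 - a)) := by
  rw [show b * (1 - a) = b + (-b) * a by ring, sym_add_mul_right ha hb hab (𝔮.neg_mem hb)]

omit [NumberField K] hreal hunit in
/-- `(a, b(1 - a)) = 1` from `(a, b) = 1`. [folklore] -/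
private theorem isCoprime_mul_one_sub {a b : 𝓞 K} (hab : IsCoprime a b) :
    IsCoprime a (b * (1 - a)) :=
  hab.mul_right ⟨1, 1, by ring⟩

/-- **The key identity in the proof of (7)**: with `t = 1 - a`, for `(a, b) ∈ W(𝔮, A)`:
`[bt² over a] = [-ta over a + bt]`, via `[bt² over 1 + bt] = 1`, (14) and (6).
[cite: Liehl1981SL2Orders, §3 (7) (proof)] -/
theorem sym_mul_sq_eq {𝔮 : Ideal (𝓞 K)} (h𝔮 : 𝔮 ≠ ⊥) {a b : 𝓞 K} (ha : a - 1 ∈ 𝔮)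
    (hab : IsCoprime a b) :
    sym 𝔮 a (b * (1 - a) * (1 - a)) = sym 𝔮 (a + b * (1 - a)) (-((1 - a) * a)) := by
  set t := 1 - a with ht
  have ht𝔮 : t ∈ 𝔮 := by rw [ht, ← neg_sub]; exact 𝔮.neg_mem ha
  have hbt : b * t ∈ 𝔮 := 𝔮.mul_mem_left _ ht𝔮
  have hbt2 : b * t * t ∈ 𝔮 := 𝔮.mul_mem_left _ ht𝔮
  have hat : IsCoprime a t := ⟨1, 1, by rw [ht]; ring⟩
  have habt2 : IsCoprime a (b * t * t) := (hab.mul_right hat).mul_right hat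
  -- `[bt² over 1 + bt] = [-t over 1 + bt] = 1`
  have h1bt : 1 + b * t - 1 ∈ 𝔮 := by rw [add_sub_cancel_left]; exact hbt
  have hc1 : IsCoprime (1 + b * t) (b * t * t) :=
    IsCoprime.mul_right ⟨1, -1, by ring⟩ ⟨1, -b, by ring⟩
  have K1 : sym 𝔮 (1 + b * t) (b * t * t) = 1 := by
    have h := sym_add_mul_right h1bt hbt2 hc1 (𝔮.neg_mem ht𝔮)
    rw [show b * t * t + -t * (1 + b * t) = -t by ring] at h
    rw [← h]
    exact sym_eq_one_of_sub_one_mem_span (𝔮.neg_mem ht𝔮)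
      (Ideal.mem_span_singleton'.2 ⟨-b, by ring⟩)
  -- (14): `[bt² over a(1 + bt)] = [bt² over a][bt² over 1 + bt]`
  have K2 := sym_mul_left hreal hunit h𝔮 ha h1bt hbt2 habt2 hc1
  rw [K1, mul_one] at K2
  -- (6): `a(1 + bt) = (a + bt) - bt²`, then `bt² - t(a + bt) = -ta`
  have ha' : a + b * t - 1 ∈ 𝔮 := by
    rw [show a + b * t - 1 = (a - 1) + b * t by ring]; exact 𝔮.add_mem ha hbt
  have hc2 : IsCoprime (a + b * t) (b * t * t) := by
    refine IsCoprime.mul_right (IsCoprime.mul_right ?_ ?_) ?_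
    · exact hab.add_mul_left_left t
    · exact ⟨1, 1 - b, by rw [ht]; ring⟩
    · exact ⟨1, 1 - b, by rw [ht]; ring⟩
  have K3 : sym 𝔮 (a * (1 + b * t)) (b * t * t) = sym 𝔮 (a + b * t) (b * t * t) := by
    rw [show a * (1 + b * t) = (a + b * t) + (-1) * (b * t * t) by rw [ht]; ring]
    exact sym_add_mul_left ha' hbt2 hc2 (-1)
  have K4 := sym_add_mul_right ha' hbt2 hc2 (𝔮.neg_mem ht𝔮)
  rw [show b * t * t + -t * (a + b * t) = -(t * a) by ring] at K4
  rw [← K2, K3, K4]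

omit [NumberField K] hreal hunit in
/-- `(a + m, ta) = 1` when `(a, m) = (t, a + m) = 1`. [folklore] -/
private theorem isCoprime_add_neg_mul {a m t : 𝓞 K} (ham : IsCoprime a m) (ht : IsCoprime (a + m) t) :
    IsCoprime (a + m) (-(t * a)) := by
  have h : IsCoprime (a + m) a := by simpa [add_comm] using ham.symm.add_mul_left_left 1
  exact (ht.mul_right h).neg_right

/-- **Liehl (7) = MS2** for the pair `(𝔮, A)`: `[b₁b₂ over a] = [b₁ over a][b₂ over a]` for
`(a, b₁), (a, b₂) ∈ W(𝔮, A)`. [cite: Liehl1981SL2Orders, §3 (7)] -/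
theorem sym_mul_right {𝔮 : Ideal (𝓞 K)} (h𝔮 : 𝔮 ≠ ⊥) {a b₁ b₂ : 𝓞 K} (ha : a - 1 ∈ 𝔮)
    (hb₁ : b₁ ∈ 𝔮) (hb₂ : b₂ ∈ 𝔮) (h₁ : IsCoprime a b₁) (h₂ : IsCoprime a b₂) :
    sym 𝔮 a (b₁ * b₂) = sym 𝔮 a b₁ * sym 𝔮 a b₂ := by
  have ht𝔮 : 1 - a ∈ 𝔮 := by rw [← neg_sub]; exact 𝔮.neg_mem ha
  have hat : IsCoprime a (1 - a) := ⟨1, 1, by ring⟩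
  have h₁₂ : IsCoprime a (b₁ * b₂) := h₁.mul_right h₂
  -- `[b] = [bt] = [bt²] (= [bt³])`, `t = 1 - a`
  have L : ∀ {b : 𝓞 K}, b ∈ 𝔮 → IsCoprime a b → sym 𝔮 a b = sym 𝔮 a (b * (1 - a) * (1 - a)) := by
    intro b hb hab
    rw [sym_eq_sym_mul_one_sub ha hb hab, sym_eq_sym_mul_one_sub ha (𝔮.mul_mem_left _ ht𝔮)
      (isCoprime_mul_one_sub hab)]
  rw [sym_eq_sym_mul_one_sub ha (𝔮.mul_mem_left _ hb₂) h₁₂, L hb₁ h₁, L hb₂ h₂,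
    L (𝔮.mul_mem_left _ ht𝔮) (isCoprime_mul_one_sub h₁₂)]
  -- the key identity for `b₁`, `b₂`, `b₁b₂t`
  rw [sym_mul_sq_eq hreal hunit h𝔮 ha h₁, sym_mul_sq_eq hreal hunit h𝔮 ha h₂,
    sym_mul_sq_eq hreal hunit h𝔮 ha (isCoprime_mul_one_sub h₁₂)]
  -- (14) and (6)
  have hta : -((1 - a) * a) ∈ 𝔮 := 𝔮.neg_mem (𝔮.mul_mem_right _ ht𝔮)
  have hA : ∀ {m : 𝓞 K}, m ∈ 𝔮 → a + m - 1 ∈ 𝔮 := fun {m} hm ↦ by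
    rw [show a + m - 1 = (a - 1) + m by ring]; exact 𝔮.add_mem ha hm
  have hm₁ : b₁ * (1 - a) ∈ 𝔮 := 𝔮.mul_mem_left b₁ ht𝔮
  have hm₂ : b₂ * (1 - a) ∈ 𝔮 := 𝔮.mul_mem_left b₂ ht𝔮
  have hm₁₂ : b₁ * b₂ * (1 - a) * (1 - a) ∈ 𝔮 := 𝔮.mul_mem_left (b₁ * b₂ * (1 - a)) ht𝔮
  have hT : ∀ m : 𝓞 K, IsCoprime (a + m * (1 - a)) (1 - a) := fun m ↦ ⟨1, 1 - m, by ring⟩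
  have hc₁ : IsCoprime (a + b₁ * (1 - a)) (-((1 - a) * a)) :=
    isCoprime_add_neg_mul (h₁.mul_right hat) (hT b₁)
  have hc₂ : IsCoprime (a + b₂ * (1 - a)) (-((1 - a) * a)) :=
    isCoprime_add_neg_mul (h₂.mul_right hat) (hT b₂)
  have hc₁₂ : IsCoprime (a + b₁ * b₂ * (1 - a) * (1 - a)) (-((1 - a) * a)) := by
    have := isCoprime_add_neg_mul ((h₁₂.mul_right hat).mul_right hat) (hT (b₁ * b₂ * (1 - a)))
    simpa [mul_assoc] using this
  have h14 := sym_mul_left hreal hunit h𝔮 (hA hm₁) (hA hm₂) hta hc₁ hc₂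
  have h6 := sym_add_mul_left (hA hm₁₂) hta hc₁₂ (1 - b₁ - b₂)
  rw [← h14, show (a + b₁ * (1 - a)) * (a + b₂ * (1 - a)) =
      (a + b₁ * b₂ * (1 - a) * (1 - a)) + (1 - b₁ - b₂) * (-((1 - a) * a)) by ring, h6]

end NumberField

end SL2Rel

end Literature.NumberTheory.Automorphic
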